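import Mathlib
import Summits.CriticalPhenomena.CardyFormulaZ2.Theorems.CardySelfRefinementGradientComparabilityOfKernels
import Summits.CriticalPhenomena.CardyFormulaZ2.Theorems.CardySelfRefinementGradientComparabilityLevelCurves
import HarnessLib

/-!
# Crux `GradientComparability` (stmt-CriticalPhenomena-10269) — line `level-curve-log-slope-identity`

Route `CardySelfRefinement`, sub-problem `CriticalPhenomena/CardyFormulaZ2`; crux decl
`Summit.CriticalPhenomena.CardyFormulaZ2.Theses.CardySelfRefinement.GradientComparability`; card
`Cruxes/GradientComparability/Ideas/level-curve-log-slope-identity.md` (crux-ideate r2, ideator 4),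
merged per the r2 triage panel (TRIAGE-r2-1 and TRIAGE-r2-2: "ONE line") with the bookkeeping of the sibling card
`level-log-gradient-identity` (transport each bulk path point along ITS OWN leaf to the slice
`ρ = 0`) and with the cross-`ρ` input typed in its weakest consumed form (the INTEGRATED bet).
Vocabulary `M A P Dρ Dc PathOK` from `Theorems/CardySelfRefinementDefs` (definitionally the route's
`let`-chain).

## The lever

For the crossing polynomial `P = P_η(ρ,c)` (fixed `k, F, η`) and any `C¹` level curve
`c = ℓ(ρ)` in the band (`ℓ' = −R`, `R := ∂ρP/∂cP`, `∂cP > 0`), Schwarz + chain rule give the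
EXACT identity
    `d/dρ [ log ∂cP(ρ, ℓ ρ) ] = (∂c R)(ρ, ℓ ρ)`                                          (★)
so a bound on the line integral of `∂cR` along a leaf (stub `stub_intBet`, THE conjecture of the
line, = the route's rank-2 second-order mechanism in integrated form) transports the `c`-pivotal
count `∂cP` itself from any bulk band point to the INDEPENDENT slice `ρ = 0`
(`sliceTransport_of_intBet`, PROVED in this file — it discharges the registered stub
`stub_sliceTransport_of_intBet` of v1/v2 verbatim).  On that slice `M_k(0,·)` is inhomogeneous
Bernoulli bond percolation (axial edges fair, non-axial edges `c`), where window stability of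
`∂cP` is Kesten's theorem in periodic dress (`stub_windowAtRhoZero`); a first-order slope bound
`|∂ρP| ≤ Λ ∂cP` at the bulk path points (`stub_slopeBound_bulk`, local surgery) turns `∂cP` into
the gradient size `G = |∂ρP| + |∂cP|`.  The corner `ρ > 1 − 2δ` is the registered CORNER stub of
line `Sketch`, verbatim (`stub_cornerTwoCharts`, shared; its proved composition
`cornerComparability` is imported).  Kesten's relation (Sketch's dead R-kernel
`stub_Drho_le_window`), the dependent-model window stability at interior `ρ` (Sketch's dead W) and
the MVT/Grönwall gap transport are needed NOWHERE.

## Composition (sorry-free, this file)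

* `sliceTransport_of_intBet` — (★) in Lean: `C²` polynomial witness `exists_contDiff_two_eq_P`,
  Schwarz `fderiv_dc_fst_eq_fderiv_dρ_snd`, the derivative form `hasDerivWithinAt_log_dc_leaf`,
  the FTC along a leaf `integral_slopeDeriv_eq_log_sub`, the IFT leaf `stub_levelCurve_IFT`
  (landed) and the identification of the line's integrand with `slopeDeriv Φ`; sorry-free.
* `bulkComparability_leaf` — stubs 1–3 ⨉ the proved transport ⨉ landed `stub_pathPoint_lower/upper` (path points lie in a
  fixed band) ⨉ landed `levelCurves_unconditional` (positivity of `∂cP` on the band) ⟹ clause (i)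
  on `{s | ρ_s ≤ 1 − δ}` for EVERY depth `δ ∈ (0,½]`:
  `G(γ s) ≤ (Λ+1)·∂cP(γ s) ≤ (Λ+1)e^Θ ∂cP(0,c₀) ≤ (Λ+1)e^Θ Λ₂ ∂cP(0,c₀') ≤ (Λ+1)Λ₂e^{2Θ} G(γ s')`;
* `comparability_leaf` — bulk chart ⨉ corner chart (`cornerComparability stub_cornerTwoCharts`)
  overlap on `ρ ∈ [1−2δ, 1−δ]`, visited by the continuous path (IVT): clause (i);
* `gradientComparability_unfolded_of_leafKernels` — clause (ii) from clause (i) and the landed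
  divergence at the Bernoulli endpoint `(0,½)` (`divergesAt_zero_half`); its type is
  `stub₁ → stub₂ → stub₃ → stub₄ → <the crux unfolded by gradientComparability_iff>`
  (section hypotheses, a closed theorem), and `GradientComparability_of : GradientComparability`
  instantiates it with the four stubs — the one theorem of the file concluding the crux BY NAME.

Disproof.lean (cdisprove gen 2 v8) used: §3 `gradientComparability_iff_envelope` (the line produces
the envelope scale `h(η) = ∂cP(0, c₀(η))` on the slice explicitly); §5e `continuous_P` /
`P_eq_sum_powerset` + landed `exists_contDiff_eq_P` (the calculus of (★) is honest: `P` is a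
polynomial on the square); §6 near-miss `gradientComparability_false_without_upperRSW` — honoured at
`stub_slopeBound_bulk` / `stub_pathPoint_upper` (the UPPER box-crossing bounds put the path points
in the band; along the §6 supercritical detour the band is empty and no leaf exists); paper-analysis
item 1 (`∂cP(1,0) → 0`): honoured — `∂cP` is transported only on `ρ ≤ 1 − δ`, the corner keeps the
sum `|∂ρP| + |∂cP|`.  No `-- Targets`, no landed `Negative/` lemma for this crux (2026-08-17).
-/

noncomputable section

namespace Summit.CriticalPhenomena.CardyFormulaZ2.Cruxes.GradientComparability.LevelCurveLogSlopeIdentity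

open scoped Topology
open Filter Set MeasureTheory
open Literature.Probability.LatticeModels Literature.Probability.Percolation
open Literature.Probability.Percolation.QuadCrossing
open Summit.CriticalPhenomena.CardyFormulaZ2.Theses.CardySelfRefinement
open Summit.CriticalPhenomena.CardyFormulaZ2.Theorems.CardySelfRefinement

/-! ### Calculus of a `C²` function on `ℝ²`: partials, Schwarz, the log-slope identity (★) -/

section Calculus

/-- First partial in `ρ` (direction `(1,0)`) of `Φ : ℝ² → ℝ`, as a function. -/
def dρ (Φ : ℝ × ℝ → ℝ) (q : ℝ × ℝ) : ℝ := fderiv ℝ Φ q (1, 0)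

/-- First partial in `c` (direction `(0,1)`) of `Φ : ℝ² → ℝ`, as a function. -/
def dc (Φ : ℝ × ℝ → ℝ) (q : ℝ × ℝ) : ℝ := fderiv ℝ Φ q (0, 1)

variable {Φ : ℝ × ℝ → ℝ}

theorem contDiff_dρ (hΦ : ContDiff ℝ 2 Φ) : ContDiff ℝ 1 (dρ Φ) := by
  have h : ContDiff ℝ 1 (fderiv ℝ Φ) := hΦ.fderiv_right (m := 1) (by norm_num)
  exact h.clm_apply contDiff_const

theorem contDiff_dc (hΦ : ContDiff ℝ 2 Φ) : ContDiff ℝ 1 (dc Φ) := by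
  have h : ContDiff ℝ 1 (fderiv ℝ Φ) := hΦ.fderiv_right (m := 1) (by norm_num)
  exact h.clm_apply contDiff_const

theorem differentiable_dρ (hΦ : ContDiff ℝ 2 Φ) : Differentiable ℝ (dρ Φ) :=
  (contDiff_dρ hΦ).differentiable one_ne_zero

theorem differentiable_dc (hΦ : ContDiff ℝ 2 Φ) : Differentiable ℝ (dc Φ) :=
  (contDiff_dc hΦ).differentiable one_ne_zero

/-- Second partials are continuous: `q ↦ ∂_w (dρ Φ)(q)` for a fixed direction `w`. -/
theorem continuous_fderiv_dρ_apply (hΦ : ContDiff ℝ 2 Φ) (w : ℝ × ℝ) :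
    Continuous fun q => fderiv ℝ (dρ Φ) q w :=
  (((contDiff_dρ hΦ).fderiv_right (m := 0) (by norm_num)).clm_apply contDiff_const).continuous

theorem continuous_fderiv_dc_apply (hΦ : ContDiff ℝ 2 Φ) (w : ℝ × ℝ) :
    Continuous fun q => fderiv ℝ (dc Φ) q w :=
  (((contDiff_dc hΦ).fderiv_right (m := 0) (by norm_num)).clm_apply contDiff_const).continuous

/-- Derivative of `y ↦ c y w` for a `CLM`-valued map `c` and a fixed vector `w`. -/
theorem hasFDerivAt_apply_const {c : ℝ × ℝ → (ℝ × ℝ →L[ℝ] ℝ)} {c' : ℝ × ℝ →L[ℝ] (ℝ × ℝ →L[ℝ] ℝ)}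
    {x : ℝ × ℝ} (hc : HasFDerivAt c c' x) (w : ℝ × ℝ) :
    HasFDerivAt (fun y => c y w) (c'.flip w) x := by
  have := hc.clm_apply (hasFDerivAt_const w x)
  simpa using this

/-- `∂_v (q ↦ fderiv Φ q w) = fderiv (fderiv Φ) q v w`. -/
theorem fderiv_partial_apply (hΦ : ContDiff ℝ 2 Φ) (q v w : ℝ × ℝ) :
    fderiv ℝ (fun y => fderiv ℝ Φ y w) q v = fderiv ℝ (fderiv ℝ Φ) q v w := by
  have hd : DifferentiableAt ℝ (fderiv ℝ Φ) q :=
    ((hΦ.fderiv_right (m := 1) (by norm_num)).differentiable one_ne_zero) q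
  rw [(hasFDerivAt_apply_const hd.hasFDerivAt w).fderiv]
  rfl

/-- **Schwarz** for the two partial functions: `∂ρ(dc Φ) = ∂c(dρ Φ)`. -/
theorem fderiv_dc_fst_eq_fderiv_dρ_snd (hΦ : ContDiff ℝ 2 Φ) (q : ℝ × ℝ) :
    fderiv ℝ (dc Φ) q (1, 0) = fderiv ℝ (dρ Φ) q (0, 1) := by
  have hsymm : IsSymmSndFDerivAt ℝ Φ q :=
    hΦ.contDiffAt.isSymmSndFDerivAt (by simp)
  have h1 : fderiv ℝ (dc Φ) q (1, 0) = fderiv ℝ (fderiv ℝ Φ) q (1, 0) (0, 1) :=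
    fderiv_partial_apply hΦ q (1, 0) (0, 1)
  have h2 : fderiv ℝ (dρ Φ) q (0, 1) = fderiv ℝ (fderiv ℝ Φ) q (0, 1) (1, 0) :=
    fderiv_partial_apply hΦ q (0, 1) (1, 0)
  rw [h1, h2, hsymm.eq]

/-- Slice derivative in `c` of a differentiable `f : ℝ² → ℝ`. -/
theorem hasDerivAt_slice_c {f : ℝ × ℝ → ℝ} (hf : Differentiable ℝ f) (ρ c : ℝ) :
    HasDerivAt (fun c' => f (ρ, c')) (fderiv ℝ f (ρ, c) (0, 1)) c := by
  have hcurve : HasDerivAt (fun c' : ℝ => ((ρ, c') : ℝ × ℝ)) ((0 : ℝ), (1 : ℝ)) c :=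
    (hasDerivAt_const c ρ).prodMk (hasDerivAt_id c)
  exact (hf (ρ, c)).hasFDerivAt.comp_hasDerivAt c hcurve

/-- The `c`-derivative of the slope field `R = dρ Φ / dc Φ` at a point where `dc Φ ≠ 0`
(quotient rule). -/
theorem hasDerivAt_slopeField (hΦ : ContDiff ℝ 2 Φ) {ρ c : ℝ} (hne : dc Φ (ρ, c) ≠ 0) :
    HasDerivAt (fun c' => dρ Φ (ρ, c') / dc Φ (ρ, c'))
      ((fderiv ℝ (dρ Φ) (ρ, c) (0, 1) * dc Φ (ρ, c) -
          dρ Φ (ρ, c) * fderiv ℝ (dc Φ) (ρ, c) (0, 1)) / dc Φ (ρ, c) ^ 2) c :=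
  (hasDerivAt_slice_c (differentiable_dρ hΦ) ρ c).div (hasDerivAt_slice_c (differentiable_dc hΦ) ρ c)
    hne

/-- **The level-curve log-slope identity (★), derivative form.**  If `ℓ` has derivative
`−dρ Φ/dc Φ` at `ρ` within `s` (the level ODE) and `dc Φ (ρ, ℓ ρ) > 0`, then
`ρ ↦ log (dc Φ (ρ, ℓ ρ))` has derivative `∂c(dρ Φ / dc Φ)(ρ, ℓ ρ)` within `s` at `ρ`. -/
theorem hasDerivWithinAt_log_dc_leaf (hΦ : ContDiff ℝ 2 Φ) {ℓ : ℝ → ℝ} {s : Set ℝ} {ρ : ℝ}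
    (hℓ : HasDerivWithinAt ℓ (-(dρ Φ (ρ, ℓ ρ) / dc Φ (ρ, ℓ ρ))) s ρ)
    (hpos : 0 < dc Φ (ρ, ℓ ρ)) :
    HasDerivWithinAt (fun x => Real.log (dc Φ (x, ℓ x)))
      ((fderiv ℝ (dρ Φ) (ρ, ℓ ρ) (0, 1) * dc Φ (ρ, ℓ ρ) -
          dρ Φ (ρ, ℓ ρ) * fderiv ℝ (dc Φ) (ρ, ℓ ρ) (0, 1)) / dc Φ (ρ, ℓ ρ) ^ 2) s ρ := by
  -- the curve `x ↦ (x, ℓ x)`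
  have hcurve : HasDerivWithinAt (fun x : ℝ => ((x, ℓ x) : ℝ × ℝ))
      ((1 : ℝ), -(dρ Φ (ρ, ℓ ρ) / dc Φ (ρ, ℓ ρ))) s ρ :=
    (hasDerivWithinAt_id ρ s).prodMk hℓ
  -- chain rule for `dc Φ` along the curve
  have hg : HasDerivWithinAt (dc Φ ∘ fun x : ℝ => ((x, ℓ x) : ℝ × ℝ))
      (fderiv ℝ (dc Φ) (ρ, ℓ ρ) ((1 : ℝ), -(dρ Φ (ρ, ℓ ρ) / dc Φ (ρ, ℓ ρ)))) s ρ :=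
    ((differentiable_dc hΦ) (ρ, ℓ ρ)).hasFDerivAt.comp_hasDerivWithinAt ρ hcurve
  have hlog := hg.log hpos.ne'
  refine hlog.congr_deriv ?_
  simp only [Function.comp_apply]
  rw [clm_apply_prod, fderiv_dc_fst_eq_fderiv_dρ_snd hΦ]
  field_simp
  ring

/-- The integrand of the line: `∂c(dρ Φ / dc Φ)` written out (quotient rule), as a function
on `ℝ²`. -/
def slopeDeriv (Φ : ℝ × ℝ → ℝ) (q : ℝ × ℝ) : ℝ :=
  (fderiv ℝ (dρ Φ) q (0, 1) * dc Φ q - dρ Φ q * fderiv ℝ (dc Φ) q (0, 1)) / dc Φ q ^ 2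

theorem continuousAt_slopeDeriv (hΦ : ContDiff ℝ 2 Φ) {q : ℝ × ℝ} (hne : dc Φ q ≠ 0) :
    ContinuousAt (slopeDeriv Φ) q := by
  unfold slopeDeriv
  refine ContinuousAt.div ?_ ?_ (pow_ne_zero 2 hne)
  · exact (((continuous_fderiv_dρ_apply hΦ (0, 1)).mul (contDiff_dc hΦ).continuous).sub
      ((contDiff_dρ hΦ).continuous.mul (continuous_fderiv_dc_apply hΦ (0, 1)))).continuousAt
  · exact ((contDiff_dc hΦ).continuous.pow 2).continuousAt

/-- `∂c(dρ Φ/dc Φ)(ρ, c) = slopeDeriv Φ (ρ, c)` as a classical derivative. -/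
theorem deriv_slopeField (hΦ : ContDiff ℝ 2 Φ) {ρ c : ℝ} (hne : dc Φ (ρ, c) ≠ 0) :
    deriv (fun c' => dρ Φ (ρ, c') / dc Φ (ρ, c')) c = slopeDeriv Φ (ρ, c) :=
  (hasDerivAt_slopeField hΦ hne).deriv

/-- **(★) integrated — fundamental theorem of calculus along a leaf.**  If `ℓ` solves the level
ODE within `[a,b]` and `dc Φ > 0` along the leaf, then
`∫_a^b slopeDeriv Φ (ρ, ℓ ρ) dρ = log dc Φ (b, ℓ b) − log dc Φ (a, ℓ a)`. -/
theorem integral_slopeDeriv_eq_log_sub (hΦ : ContDiff ℝ 2 Φ) {a b : ℝ} (hab : a ≤ b)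
    {ℓ : ℝ → ℝ}
    (hℓ : ∀ ρ ∈ Icc a b, HasDerivWithinAt ℓ (-(dρ Φ (ρ, ℓ ρ) / dc Φ (ρ, ℓ ρ))) (Icc a b) ρ)
    (hpos : ∀ ρ ∈ Icc a b, 0 < dc Φ (ρ, ℓ ρ)) :
    ∫ ρ in a..b, slopeDeriv Φ (ρ, ℓ ρ) =
      Real.log (dc Φ (b, ℓ b)) - Real.log (dc Φ (a, ℓ a)) := by
  have hD : ∀ ρ ∈ Icc a b, HasDerivWithinAt (fun x => Real.log (dc Φ (x, ℓ x)))
      (slopeDeriv Φ (ρ, ℓ ρ)) (Icc a b) ρ :=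
    fun ρ hρ => hasDerivWithinAt_log_dc_leaf hΦ (hℓ ρ hρ) (hpos ρ hρ)
  refine intervalIntegral.integral_eq_sub_of_hasDeriv_right_of_le
    (f := fun x => Real.log (dc Φ (x, ℓ x))) (f' := fun ρ => slopeDeriv Φ (ρ, ℓ ρ)) hab ?_ ?_ ?_
  · exact fun ρ hρ => (hD ρ hρ).continuousWithinAt
  · intro x hx
    exact ((hD x (Ioo_subset_Icc_self hx)).hasDerivAt (Icc_mem_nhds hx.1 hx.2)).hasDerivWithinAt
  · refine ContinuousOn.intervalIntegrable_of_Icc hab fun ρ hρ => ?_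
    have hc : ContinuousWithinAt (fun x : ℝ => ((x, ℓ x) : ℝ × ℝ)) (Icc a b) ρ :=
      continuousWithinAt_id.prodMk (hℓ ρ hρ).continuousWithinAt
    have hcomp : ContinuousWithinAt (slopeDeriv Φ ∘ fun x : ℝ => ((x, ℓ x) : ℝ × ℝ)) (Icc a b) ρ :=
      ContinuousAt.comp_continuousWithinAt (g := slopeDeriv Φ)
        (f := fun x : ℝ => ((x, ℓ x) : ℝ × ℝ)) (x := ρ)
        (continuousAt_slopeDeriv hΦ (hpos ρ hρ).ne') hc
    exact hcomp

end Calculus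

/-! ### `P` is a polynomial on the square: the `C²` (indeed `C^∞`) witness -/

/-- `P` agrees on `[0,1]²` with a `C²` function on `ℝ²` (the same polynomial witness as the landed
`exists_contDiff_eq_P`, whose statement only records `C¹`). -/
theorem exists_contDiff_two_eq_P (k m : ℕ) (F : Fin m → Quad (Set.univ : Set ℂ)) {η : ℝ}
    (hη : η ≠ 0) :
    ∃ Φ : ℝ × ℝ → ℝ, ContDiff ℝ 2 Φ ∧
      ∀ ρ ∈ Set.Icc (0 : ℝ) 1, ∀ c ∈ Set.Icc (0 : ℝ) 1, P k m F η ρ c = Φ (ρ, c) := by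
  classical
  obtain ⟨K, hK⟩ := exists_coinFinset k m F hη
  let b : (Site 2 × Fin 2 × Fin 3) → ℝ × ℝ → ℝ := fun i q =>
    if i.2.2 = 0 then (if ax k (i.1, i.2.1) then 1 / 2 else q.2) else if i.2.2 = 1 then 1 / 2 else q.1
  have hb : ∀ i, ContDiff ℝ 2 (b i) := by
    intro i
    simp only [b]
    split_ifs
    exacts [contDiff_const, contDiff_snd, contDiff_const, contDiff_fst]
  refine ⟨fun q => ∑ S ∈ K.powerset,
      if (↑S : Set (Site 2 × Fin 2 × Fin 3)) ∈ (cfg k) ⁻¹' Aloc m F η then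
        ∏ i ∈ K, (if i ∈ S then b i q else 1 - b i q) else 0, ?_, ?_⟩
  · refine ContDiff.sum fun S _ => ?_
    split_ifs
    · exact contDiff_prod fun i _ => by
        split_ifs
        exacts [hb i, contDiff_const.sub (hb i)]
    · exact contDiff_const
  · intro ρ hρ c hc
    rw [P_eq_sum_powerset k m F hη ρ c K hK]
    refine Finset.sum_congr rfl fun S _ => ?_
    split_ifs with hS
    · refine Finset.prod_congr rfl fun i _ => ?_
      have hi : (prm k ρ c i : ℝ) = b i (ρ, c) := by
        rw [coe_prm_eq k hρ hc i]
      rw [hi]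
    · rfl

/-! ### The transport theorem (the registered stub `stub_sliceTransport_of_intBet`, PROVED) -/

/-- **Leaf transport to the slice `ρ = 0` from the integrated bet** — the registered signature of
`stub_sliceTransport_of_intBet`, proved: for every mesh below the (path-free) boundary-value
threshold, the mesh-`η` instance of ∫BET implies that every bulk band point `(ρ', c')` has a
same-level partner `c₀` on the slice `ρ = 0` with `e^{-Θ} ≤ ∂cP(ρ',c')/∂cP(0,c₀) ≤ e^{Θ}`.
Proof: the leaf `ℓ` through `(ρ',c')` (IFT at level `v = P(ρ',c')`), `c₀ = ℓ 0`, the identity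
(★) integrated along the leaf (`integral_slopeDeriv_eq_log_sub`), and the identification of the
line's integrand `derivWithin (c ↦ Dρ/Dc) [0,1] (ℓ ρ)` with `slopeDeriv Φ (ρ, ℓ ρ)`. -/
theorem sliceTransport_of_intBet :
    ∀ k : ℕ, k = 2 ∨ k = 3 → ∀ (m : ℕ) (F : Fin m → Quad (Set.univ : Set ℂ)), 0 < m →
      ∀ δ : ℝ, 0 < δ → δ ≤ 1 / 2 → ∀ vlo vhi : ℝ, 0 < vlo → vlo < vhi → vhi < 1 →
        ∀ Θ : ℝ, 0 ≤ Θ → ∃ η₂ : ℝ, 0 < η₂ ∧ ∀ η ∈ Set.Ioo 0 η₂,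
          (∀ v ∈ Set.Icc vlo vhi, ∀ ℓ : ℝ → ℝ,
            (∀ ρ ∈ Set.Icc (0 : ℝ) (1 - δ), ℓ ρ ∈ Set.Icc (0 : ℝ) 1 ∧ P k m F η ρ (ℓ ρ) = v) →
            (∀ ρ ∈ Set.Icc (0 : ℝ) (1 - δ), HasDerivWithinAt ℓ
                (-(Dρ k m F η (ρ, ℓ ρ) / Dc k m F η (ρ, ℓ ρ))) (Set.Icc 0 (1 - δ)) ρ) →
            ∀ ρ₀ ∈ Set.Icc (0 : ℝ) (1 - δ), ∀ ρ₁ ∈ Set.Icc (0 : ℝ) (1 - δ),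
              |∫ ρ in ρ₀..ρ₁, derivWithin (fun c => Dρ k m F η (ρ, c) / Dc k m F η (ρ, c))
                  (Set.Icc 0 1) (ℓ ρ)| ≤ Θ) →
          ∀ ρ' ∈ Set.Icc (0 : ℝ) (1 - δ), ∀ c' ∈ Set.Icc (0 : ℝ) 1,
            P k m F η ρ' c' ∈ Set.Icc vlo vhi →
              ∃ c₀ ∈ Set.Icc (0 : ℝ) 1, P k m F η 0 c₀ = P k m F η ρ' c' ∧
                Dc k m F η (ρ', c') ≤ Real.exp Θ * Dc k m F η (0, c₀) ∧
                Dc k m F η (0, c₀) ≤ Real.exp Θ * Dc k m F η (ρ', c') := by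
  intro k hk m F hm δ hδ hδ' vlo vhi hvlo hvv hvhi Θ hΘ
  -- path-free boundary values: `P(ρ,0) < vlo` on the bulk and `P(ρ,1) = 1`, for small mesh
  have hev := (P_zero_lt_eventually hk F hm hδ hδ' hvlo).and (P_one_eq_one_eventually hk m F)
  rw [eventually_nhdsWithin_iff, Metric.eventually_nhds_iff] at hev
  obtain ⟨ε, hε, hall⟩ := hev
  refine ⟨ε, hε, fun η hη hIB ρ' hρ' c' hc' hband => ?_⟩
  obtain ⟨hlo, hhi⟩ := hall (by rw [Real.dist_eq, sub_zero, abs_of_pos hη.1]; exact hη.2) hη.1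
  have hη0 : η ≠ 0 := hη.1.ne'
  -- the `C²` polynomial `Φ = P` on the square and its partials `dρ Φ = Dρ`, `dc Φ = Dc` there
  obtain ⟨Φ, hΦ, hPΦ⟩ := exists_contDiff_two_eq_P k m F hη0
  have hΦ1 : ContDiff ℝ 1 Φ := hΦ.of_le (by norm_num)
  have hΦd : Differentiable ℝ Φ := hΦ.differentiable (by norm_num)
  have hDρ : ∀ ρ ∈ Set.Icc (0 : ℝ) 1, ∀ c ∈ Set.Icc (0 : ℝ) 1,
      Dρ k m F η (ρ, c) = dρ Φ (ρ, c) := fun ρ hρ c hc =>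
    derivWithin_eq_fderiv_fst (hΦd (ρ, c)) hρ (fun ρ'' hρ'' => hPΦ ρ'' hρ'' c hc)
  have hDc : ∀ ρ ∈ Set.Icc (0 : ℝ) 1, ∀ c ∈ Set.Icc (0 : ℝ) 1,
      Dc k m F η (ρ, c) = dc Φ (ρ, c) := fun ρ hρ c hc =>
    derivWithin_eq_fderiv_snd (hΦd (ρ, c)) hc (fun c'' hc'' => hPΦ ρ hρ c'' hc'')
  have hI : ∀ ρ ∈ Set.Icc (0 : ℝ) (1 - δ), ρ ∈ Set.Icc (0 : ℝ) 1 :=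
    fun ρ hρ => ⟨hρ.1, by linarith [hρ.2]⟩
  have h0 : (0 : ℝ) ∈ Set.Icc (0 : ℝ) 1 := ⟨le_rfl, zero_le_one⟩
  have h1 : (1 : ℝ) ∈ Set.Icc (0 : ℝ) 1 := ⟨zero_le_one, le_rfl⟩
  have h0δ : (0 : ℝ) ∈ Set.Icc (0 : ℝ) (1 - δ) := ⟨le_rfl, by linarith⟩
  -- the level `v` of the band point
  set v : ℝ := P k m F η ρ' c' with hv_def
  have hv : v ∈ Set.Icc vlo vhi := hband
  -- hypotheses of the implicit function theorem at level `v`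
  have hmonoΦ : ∀ ρ ∈ Set.Icc (0 : ℝ) (1 - δ), MonotoneOn (fun c => Φ (ρ, c)) (Set.Icc 0 1) := by
    intro ρ hρ c hc c'' hc'' hcc
    show Φ (ρ, c) ≤ Φ (ρ, c'')
    rw [← hPΦ ρ (hI ρ hρ) c hc, ← hPΦ ρ (hI ρ hρ) c'' hc'']
    exact P_mono_c k m F hη0 ρ hcc
  have hbv : ∀ ρ ∈ Set.Icc (0 : ℝ) (1 - δ), Φ (ρ, 0) < v ∧ v < Φ (ρ, 1) := by
    intro ρ hρ
    rw [← hPΦ ρ (hI ρ hρ) 0 h0, ← hPΦ ρ (hI ρ hρ) 1 h1, hhi ρ]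
    exact ⟨lt_of_lt_of_le (hlo ρ hρ) hv.1, lt_of_le_of_lt hv.2 hvhi⟩
  have hPOS : ∀ ρ ∈ Set.Icc (0 : ℝ) (1 - δ), ∀ c ∈ Set.Icc (0 : ℝ) 1,
      P k m F η ρ c = v → 0 < Dc k m F η (ρ, c) := by
    intro ρ hρ c hc hPc
    have hρ01 : ρ ∈ Set.Icc (0 : ℝ) 1 := hI ρ hρ
    have hc0 : c ≠ 0 := by
      rintro rfl; linarith [hlo ρ hρ, hv.1]
    have hc1 : c ≠ 1 := by
      rintro rfl; rw [hhi ρ] at hPc; linarith [hv.2]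
    have hcI : c ∈ Set.Ioo (0 : ℝ) 1 := ⟨lt_of_le_of_ne hc.1 (Ne.symm hc0), lt_of_le_of_ne hc.2 hc1⟩
    refine stub_Dc_pos_of_nonconstant k m F hη0 hρ01 hcI ?_
    intro hconst
    have := hconst 0 h0
    rw [hPc] at this
    linarith [hlo ρ hρ, hv.1]
  have hposΦ : ∀ ρ ∈ Set.Icc (0 : ℝ) (1 - δ), ∀ c ∈ Set.Icc (0 : ℝ) 1,
      Φ (ρ, c) = v → 0 < fderiv ℝ Φ (ρ, c) (0, 1) := by
    intro ρ hρ c hc hcv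
    have := hPOS ρ hρ c hc (by rw [hPΦ ρ (hI ρ hρ) c hc, hcv])
    rwa [hDc ρ (hI ρ hρ) c hc] at this
  -- the leaf through `(ρ', c')`
  obtain ⟨ℓ, hℓ, hℓ'⟩ := stub_levelCurve_IFT Φ hΦ1 0 (1 - δ) v hbv hmonoΦ hposΦ
  have hℓ01 : ∀ ρ ∈ Set.Icc (0 : ℝ) (1 - δ), ℓ ρ ∈ Set.Icc (0 : ℝ) 1 := fun ρ hρ =>
    ⟨(hℓ ρ hρ).1.1.le, (hℓ ρ hρ).1.2.le⟩
  have hPℓ : ∀ ρ ∈ Set.Icc (0 : ℝ) (1 - δ), P k m F η ρ (ℓ ρ) = v := fun ρ hρ => by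
    rw [hPΦ ρ (hI ρ hρ) _ (hℓ01 ρ hρ)]; exact (hℓ ρ hρ).2.1
  have hℓρ' : ℓ ρ' = c' :=
    ((hℓ ρ' hρ').2.2 c' hc' (by rw [← hPΦ ρ' (hI ρ' hρ') c' hc'])).symm
  -- positivity of `dc Φ` along the leaf, and the leaf ODE in `dρ/dc` form
  have hposleaf : ∀ ρ ∈ Set.Icc (0 : ℝ) (1 - δ), 0 < dc Φ (ρ, ℓ ρ) := fun ρ hρ =>
    hposΦ ρ hρ (ℓ ρ) (hℓ01 ρ hρ) (hℓ ρ hρ).2.1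
  have hODE : ∀ ρ ∈ Set.Icc (0 : ℝ) (1 - δ), HasDerivWithinAt ℓ
      (-(dρ Φ (ρ, ℓ ρ) / dc Φ (ρ, ℓ ρ))) (Set.Icc 0 (1 - δ)) ρ := fun ρ hρ => hℓ' ρ hρ
  have hODE' : ∀ ρ ∈ Set.Icc (0 : ℝ) (1 - δ), HasDerivWithinAt ℓ
      (-(Dρ k m F η (ρ, ℓ ρ) / Dc k m F η (ρ, ℓ ρ))) (Set.Icc 0 (1 - δ)) ρ := by
    intro ρ hρ
    refine (hODE ρ hρ).congr_deriv ?_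
    rw [hDρ ρ (hI ρ hρ) _ (hℓ01 ρ hρ), hDc ρ (hI ρ hρ) _ (hℓ01 ρ hρ)]
  -- ∫BET at mesh `η` along this leaf, between `0` and `ρ'`
  have hbet := hIB v hv ℓ (fun ρ hρ => ⟨hℓ01 ρ hρ, hPℓ ρ hρ⟩) hODE' 0 h0δ ρ' hρ'
  -- the line's integrand is `slopeDeriv Φ` along the leaf
  have hint_eq : ∀ ρ ∈ Set.Icc (0 : ℝ) (1 - δ),
      derivWithin (fun c => Dρ k m F η (ρ, c) / Dc k m F η (ρ, c)) (Set.Icc 0 1) (ℓ ρ) =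
        slopeDeriv Φ (ρ, ℓ ρ) := by
    intro ρ hρ
    have heq : Set.EqOn (fun c => Dρ k m F η (ρ, c) / Dc k m F η (ρ, c))
        (fun c => dρ Φ (ρ, c) / dc Φ (ρ, c)) (Set.Icc 0 1) := by
      intro c hc
      simp only [hDρ ρ (hI ρ hρ) c hc, hDc ρ (hI ρ hρ) c hc]
    rw [derivWithin_congr heq (heq (hℓ01 ρ hρ)),
      derivWithin_of_mem_nhds (Icc_mem_nhds (hℓ ρ hρ).1.1 (hℓ ρ hρ).1.2),
      deriv_slopeField hΦ (hposleaf ρ hρ).ne']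
  have hIcc_sub : Set.Icc (0 : ℝ) ρ' ⊆ Set.Icc (0 : ℝ) (1 - δ) := Set.Icc_subset_Icc le_rfl hρ'.2
  have hint_congr : ∫ ρ in (0 : ℝ)..ρ', derivWithin (fun c => Dρ k m F η (ρ, c) / Dc k m F η (ρ, c))
      (Set.Icc 0 1) (ℓ ρ) = ∫ ρ in (0 : ℝ)..ρ', slopeDeriv Φ (ρ, ℓ ρ) := by
    refine intervalIntegral.integral_congr fun ρ hρ => ?_
    rw [Set.uIcc_of_le hρ'.1] at hρ
    exact hint_eq ρ (hIcc_sub hρ)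
  -- (★) integrated along the leaf from `0` to `ρ'`
  have hFTC : ∫ ρ in (0 : ℝ)..ρ', slopeDeriv Φ (ρ, ℓ ρ) =
      Real.log (dc Φ (ρ', ℓ ρ')) - Real.log (dc Φ (0, ℓ 0)) :=
    integral_slopeDeriv_eq_log_sub hΦ hρ'.1
      (fun ρ hρ => (hODE ρ (hIcc_sub hρ)).mono hIcc_sub) (fun ρ hρ => hposleaf ρ (hIcc_sub hρ))
  -- the log-variation bound
  have hlogbd : |Real.log (dc Φ (ρ', ℓ ρ')) - Real.log (dc Φ (0, ℓ 0))| ≤ Θ := by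
    rw [← hFTC, ← hint_congr]; exact hbet
  -- conclusion, with `c₀ = ℓ 0`
  have ha : 0 < dc Φ (ρ', ℓ ρ') := hposleaf ρ' hρ'
  have hb : 0 < dc Φ (0, ℓ 0) := hposleaf 0 h0δ
  have hDc' : Dc k m F η (ρ', c') = dc Φ (ρ', ℓ ρ') := by
    rw [← hℓρ']; exact hDc ρ' (hI ρ' hρ') _ (hℓ01 ρ' hρ')
  have hDc0 : Dc k m F η (0, ℓ 0) = dc Φ (0, ℓ 0) := hDc 0 h0 _ (hℓ01 0 h0δ)
  refine ⟨ℓ 0, hℓ01 0 h0δ, ?_, ?_, ?_⟩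
  · rw [hPℓ 0 h0δ]
  · rw [hDc', hDc0]
    have h := (abs_le.1 hlogbd).2
    calc dc Φ (ρ', ℓ ρ') = Real.exp (Real.log (dc Φ (ρ', ℓ ρ'))) := (Real.exp_log ha).symm
      _ ≤ Real.exp (Θ + Real.log (dc Φ (0, ℓ 0))) := Real.exp_le_exp.2 (by linarith)
      _ = Real.exp Θ * dc Φ (0, ℓ 0) := by rw [Real.exp_add, Real.exp_log hb]
  · rw [hDc', hDc0]
    have h := (abs_le.1 hlogbd).1
    calc dc Φ (0, ℓ 0) = Real.exp (Real.log (dc Φ (0, ℓ 0))) := (Real.exp_log hb).symm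
      _ ≤ Real.exp (Θ + Real.log (dc Φ (ρ', ℓ ρ'))) := Real.exp_le_exp.2 (by linarith)
      _ = Real.exp Θ * dc Φ (ρ', ℓ ρ') := by rw [Real.exp_add, Real.exp_log ha]

/-! ## Stubs (four registered sub-goals; the fifth of v1/v2, `stub_sliceTransport_of_intBet`, is
now the proved theorem `sliceTransport_of_intBet` above) -/

/-- **Stub 1 (first-order slope bound at the bulk path points; size L).**  For an RSW path `γ`, a
nonempty quad family and a depth `δ ∈ (0,½]`: at every path point with `ρ_s ≤ 1 − δ` and every small
mesh, `|∂ρP(γ s)| ≤ Λ · ∂cP(γ s)` with a MESH-UNIFORM `Λ`.  Mechanism: `∂ρP` is the signed sum of the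
selector influences (`stub_Drho_eq_signed_sum`; for `k = 2` the influence of a bundle is
`¼(g(1) − g(0))` with `g(a) = M(e₂ pivotal | e₁ = a)`, so `|∂ρP| ≤ ½ Σ_{axial e} M(e pivotal)`), and an
axial pivotal edge is turned into a pivotal NON-axial edge of a bounded patch by a finite-energy
local modification whose cost is uniform in `ρ ≤ 1 − δ` (selector off with probability `≥ δ`) and in
`c_s ∈ [c_lo, c_hi] ⊂ (0,1)` (path points: two-sided box bounds exclude `c → 0` — subcritical coarse
Bernoulli `M_k(ρ,0)`, `ρ ≤ 1−δ` — and `c → 1` — the open odd grid); `∂cP = Σ_{non-axial} M(e pivotal)`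
(`stub_Dc_eq_sum_pivotal`).  Bulk half of the surgery landed (`local_modification`,
`stub_nonAxialShare_bulk`); the boundary layer of quads with wild (non-rectifiable) sides is NOT
controlled by any known argument (NegativeNote-NonAxialTransfer.md) — the crux quantifies over all
Jordan quads, so this stub does too.  Aizenman–Grimmett 1991 (essential enhancements: the local
modification pattern), Grimmett 1999 §2.4. -/
theorem stub_slopeBound_bulk :
    ∀ k : ℕ, k = 2 ∨ k = 3 → ∀ γ : unitInterval → ℝ × ℝ, PathOK k γ →
      ∀ (m : ℕ) (F : Fin m → Quad (Set.univ : Set ℂ)), 0 < m → ∀ δ : ℝ, 0 < δ → δ ≤ 1 / 2 →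
        ∃ Λ η₁ : ℝ, 0 ≤ Λ ∧ 0 < η₁ ∧ ∀ η ∈ Set.Ioo 0 η₁, ∀ s : unitInterval, (γ s).1 ≤ 1 - δ →
          |Dρ k m F η (γ s)| ≤ Λ * Dc k m F η (γ s) := by
  sorry

/-- **Stub 2 (Kesten's window stability on the INDEPENDENT slice `ρ = 0`; size L, Bernoulli class).**
For a nonempty quad family and two levels `0 < vlo < vhi < 1`: across the finite-size window
`{c ∈ [0,1] : P_η(0,c) ∈ [vlo, vhi]}` of the slice `ρ = 0` — where `M_k(0,c)` is INDEPENDENT bond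
percolation on `ℤ²` with axial edges fair and non-axial edges of bias `c` (a `k`-periodic
inhomogeneous Bernoulli model, critical window around `c = ½` = `P_{1/2}`) — the Russo derivative
`∂cP = Σ_{non-axial e} P(e pivotal)` varies by at most a MESH-UNIFORM factor `Λ₂`.  Kesten 1987
(Thm 1 / Lemma 8: four-arm events are stable inside the near-critical window), Nolin 2008 §6,
Duminil-Copin–Manolescu–Tassion arXiv:2111.14414 Rem. 2.3 (Russo-free template); edge-class Russo
sums, only the non-axial class moves.  Nearest tree facts: `Kesten1987_zdFourArmStability`,
`Kesten1987_zdPivotalCount_sameParam` (ZdKestenRelationInputs.lean; homogeneous `t`, UNPROVED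
`def … : Prop` — the tree's standing Bernoulli debt, which this stub needs in periodic-inhomogeneous
dress; no dependent-model (`ρ > 0`) window statement is asked anywhere in this line). -/
theorem stub_windowAtRhoZero :
    ∀ k : ℕ, k = 2 ∨ k = 3 → ∀ (m : ℕ) (F : Fin m → Quad (Set.univ : Set ℂ)), 0 < m →
      ∀ vlo vhi : ℝ, 0 < vlo → vlo < vhi → vhi < 1 →
        ∃ Λ₂ η₂ : ℝ, 0 < Λ₂ ∧ 0 < η₂ ∧ ∀ η ∈ Set.Ioo 0 η₂,
          ∀ c ∈ Set.Icc (0 : ℝ) 1, ∀ c' ∈ Set.Icc (0 : ℝ) 1,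
            P k m F η 0 c ∈ Set.Icc vlo vhi → P k m F η 0 c' ∈ Set.Icc vlo vhi →
              Dc k m F η (0, c) ≤ Λ₂ * Dc k m F η (0, c') := by
  sorry

/-- **Stub 3 (∫BET — the integrated transversal-slope bet; THE conjecture of the line, size XL /
open: = the route's rank-2 second-order mechanism `TrivialSectorRate`, in its weakest form used).**
For `k ∈ {2,3}`, a nonempty quad family, a depth `δ ∈ (0,½]` and levels `0 < vlo < vhi < 1` there are
a MESH-UNIFORM `Θ ≥ 0` and a threshold `η₁ > 0` such that for every mesh `η < η₁`, every level
`v ∈ [vlo,vhi]`, every level selection `ℓ` of `P_η` at level `v` over `ρ ∈ [0, 1−δ]` (values in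
`[0,1]`) solving the level ODE `ℓ' = −∂ρP/∂cP` within `[0, 1−δ]`, and all `ρ₀, ρ₁ ≤ 1 − δ`:
`|∫_{ρ₀}^{ρ₁} ∂cR(ρ, ℓ ρ) dρ| ≤ Θ`, where `∂cR = derivWithin (c ↦ ∂ρP/∂cP) [0,1]`.  By (★) the
integrand is `d/dρ log ∂cP(ρ, ℓ ρ)` (a continuous function along every admissible `ℓ` — no junk
integral), so this is EXACTLY "log ∂cP varies by at most Θ along each finite-size leaf".  It is
implied by the registered pointwise bet `stub_transversalSlopeLipschitz` of line `Sketch`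
(`R` Θ-Lipschitz in `c` across the band ⟹ `|∂cR| ≤ Θ` ⟹ `|∫| ≤ Θ·|ρ₁ − ρ₀| ≤ Θ`), MC-supported for
`k = 2` at `ρ ∈ {0, .5, .85}`, `L ≤ 1024` (MC-BetVerdict.md, MC-BetVerdict-1dep.md: `|∂c log R|` flat
`6.6/7.3/7.4/7.6/5.8` over four octaves, null ×1.68/doubling rejected), and strictly weaker
(tolerates integrable blow-up of `∂cR` and oscillation); conversely GC(i) ∧ stubs 1–2 ⟹ ∫BET with
`Θ = log` of the comparability constants (card §(3)), so this stub is exactly the cross-`ρ` content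
of the crux.  Why it might fail: a marginal rotation-scalar 4-leg correction of gap exactly `3/4`
would make `∫BET ~ log(1/η)` (card `monotone-product-coordinates`, threshold analysis); `k = 3` has
no Monte-Carlo on record.  Garban–Pete–Schramm 2013 §5 (ratio limits of pivotal measures: the
natural technology), Kesten 1987, Nolin 2008 §6, Beffara arXiv:0708.3908 §5.2. -/
theorem stub_intBet :
    ∀ k : ℕ, k = 2 ∨ k = 3 → ∀ (m : ℕ) (F : Fin m → Quad (Set.univ : Set ℂ)), 0 < m →
      ∀ δ : ℝ, 0 < δ → δ ≤ 1 / 2 → ∀ vlo vhi : ℝ, 0 < vlo → vlo < vhi → vhi < 1 →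
        ∃ Θ η₁ : ℝ, 0 ≤ Θ ∧ 0 < η₁ ∧ ∀ η ∈ Set.Ioo 0 η₁,
          ∀ v ∈ Set.Icc vlo vhi, ∀ ℓ : ℝ → ℝ,
            (∀ ρ ∈ Set.Icc (0 : ℝ) (1 - δ), ℓ ρ ∈ Set.Icc (0 : ℝ) 1 ∧ P k m F η ρ (ℓ ρ) = v) →
            (∀ ρ ∈ Set.Icc (0 : ℝ) (1 - δ), HasDerivWithinAt ℓ
                (-(Dρ k m F η (ρ, ℓ ρ) / Dc k m F η (ρ, ℓ ρ))) (Set.Icc 0 (1 - δ)) ρ) →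
            ∀ ρ₀ ∈ Set.Icc (0 : ℝ) (1 - δ), ∀ ρ₁ ∈ Set.Icc (0 : ℝ) (1 - δ),
              |∫ ρ in ρ₀..ρ₁, derivWithin (fun c => Dρ k m F η (ρ, c) / Dc k m F η (ρ, c))
                  (Set.Icc 0 1) (ℓ ρ)| ≤ Θ := by
  sorry

/-- **Stub 4 (the two corner charts near the endpoint `(1,0)`; size XL — the registered CORNER stub
of line `Sketch`, VERBATIM and shared; its proved composition `cornerComparability` is imported).**
A mesh-dependent width `w(η) → 0⁺` and two sub-charts sharing it: the TIP `{s | 1 − a·w(η) ≤ ρ_s}`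
(comparability for every aperture `a > 0`: a Kesten box of the Bernoulli corner model
`M_k(1,0) = P_{1/2}` at mesh `kη`, in the sibling card's monotone coin coordinates a 3-parameter
window at an INDEPENDENT critical point) and the `c`-CHART `{s | 1 − 2δ ≤ ρ_s ≤ 1 − a·w(η)}`
(comparability for some aperture and depth; suggested mechanism: the corner twin of (★),
`d/dc log ∂ρP(h_v(c), c) = ∂ρ(∂cP/∂ρP)`, transporting `∂ρP` along the leaves written as graphs
`ρ = h_v(c)`, plus a corner ∫BET and the corner slope bound `∂cP ≤ C|∂ρP|`, `∂ρP > 0` — the sibling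
line `level-log-gradient-identity` develops this split).  This line changes nothing at the corner. -/
theorem stub_cornerTwoCharts :
    ∀ k : ℕ, k = 2 ∨ k = 3 → ∀ γ : unitInterval → ℝ × ℝ, PathOK k γ →
      ∀ (m : ℕ) (F : Fin m → Quad (Set.univ : Set ℂ)), 0 < m →
        ∃ w : ℝ → ℝ, Tendsto w (𝓝[>] 0) (𝓝 0) ∧ (∀ η : ℝ, 0 < η → 0 < w η) ∧
          (∀ a : ℝ, 0 < a → ∃ Λ₃ η₃ : ℝ, 0 < η₃ ∧ ∀ η ∈ Set.Ioo 0 η₃, ∀ s s' : unitInterval,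
            1 - a * w η ≤ (γ s).1 → 1 - a * w η ≤ (γ s').1 →
              |Dρ k m F η (γ s)| + |Dc k m F η (γ s)| ≤
                Λ₃ * (|Dρ k m F η (γ s')| + |Dc k m F η (γ s')|)) ∧
          (∃ a δ : ℝ, 0 < a ∧ 0 < δ ∧ δ ≤ 1 / 2 ∧ ∃ Λ₄ η₄ : ℝ, 0 < η₄ ∧
            ∀ η ∈ Set.Ioo 0 η₄, ∀ s s' : unitInterval,
              1 - 2 * δ ≤ (γ s).1 → (γ s).1 ≤ 1 - a * w η →
              1 - 2 * δ ≤ (γ s').1 → (γ s').1 ≤ 1 - a * w η →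
                |Dρ k m F η (γ s)| + |Dc k m F η (γ s)| ≤
                  Λ₄ * (|Dρ k m F η (γ s')| + |Dc k m F η (γ s')|)) := by
  sorry

/-! ## Composition (sorry-free glue)

The four stub statements are taken as section hypotheses with the stubs' literal signatures, so
that `gradientComparability_unfolded_of_leafKernels : stub₁ → stub₂ → stub₃ → stub₄ →
<crux unfolded>` is a closed theorem; `GradientComparability_of` instantiates it with the stubs and
concludes the crux decl by name. -/

section Glue

variable (hSB :
    ∀ k : ℕ, k = 2 ∨ k = 3 → ∀ γ : unitInterval → ℝ × ℝ, PathOK k γ →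
      ∀ (m : ℕ) (F : Fin m → Quad (Set.univ : Set ℂ)), 0 < m → ∀ δ : ℝ, 0 < δ → δ ≤ 1 / 2 →
        ∃ Λ η₁ : ℝ, 0 ≤ Λ ∧ 0 < η₁ ∧ ∀ η ∈ Set.Ioo 0 η₁, ∀ s : unitInterval, (γ s).1 ≤ 1 - δ →
          |Dρ k m F η (γ s)| ≤ Λ * Dc k m F η (γ s))

variable (hW0 :
    ∀ k : ℕ, k = 2 ∨ k = 3 → ∀ (m : ℕ) (F : Fin m → Quad (Set.univ : Set ℂ)), 0 < m →
      ∀ vlo vhi : ℝ, 0 < vlo → vlo < vhi → vhi < 1 →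
        ∃ Λ₂ η₂ : ℝ, 0 < Λ₂ ∧ 0 < η₂ ∧ ∀ η ∈ Set.Ioo 0 η₂,
          ∀ c ∈ Set.Icc (0 : ℝ) 1, ∀ c' ∈ Set.Icc (0 : ℝ) 1,
            P k m F η 0 c ∈ Set.Icc vlo vhi → P k m F η 0 c' ∈ Set.Icc vlo vhi →
              Dc k m F η (0, c) ≤ Λ₂ * Dc k m F η (0, c'))

variable (hIB :
    ∀ k : ℕ, k = 2 ∨ k = 3 → ∀ (m : ℕ) (F : Fin m → Quad (Set.univ : Set ℂ)), 0 < m →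
      ∀ δ : ℝ, 0 < δ → δ ≤ 1 / 2 → ∀ vlo vhi : ℝ, 0 < vlo → vlo < vhi → vhi < 1 →
        ∃ Θ η₁ : ℝ, 0 ≤ Θ ∧ 0 < η₁ ∧ ∀ η ∈ Set.Ioo 0 η₁,
          ∀ v ∈ Set.Icc vlo vhi, ∀ ℓ : ℝ → ℝ,
            (∀ ρ ∈ Set.Icc (0 : ℝ) (1 - δ), ℓ ρ ∈ Set.Icc (0 : ℝ) 1 ∧ P k m F η ρ (ℓ ρ) = v) →
            (∀ ρ ∈ Set.Icc (0 : ℝ) (1 - δ), HasDerivWithinAt ℓ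
                (-(Dρ k m F η (ρ, ℓ ρ) / Dc k m F η (ρ, ℓ ρ))) (Set.Icc 0 (1 - δ)) ρ) →
            ∀ ρ₀ ∈ Set.Icc (0 : ℝ) (1 - δ), ∀ ρ₁ ∈ Set.Icc (0 : ℝ) (1 - δ),
              |∫ ρ in ρ₀..ρ₁, derivWithin (fun c => Dρ k m F η (ρ, c) / Dc k m F η (ρ, c))
                  (Set.Icc 0 1) (ℓ ρ)| ≤ Θ)

variable (hCO :
    ∀ k : ℕ, k = 2 ∨ k = 3 → ∀ γ : unitInterval → ℝ × ℝ, PathOK k γ →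
      ∀ (m : ℕ) (F : Fin m → Quad (Set.univ : Set ℂ)), 0 < m →
        ∃ w : ℝ → ℝ, Tendsto w (𝓝[>] 0) (𝓝 0) ∧ (∀ η : ℝ, 0 < η → 0 < w η) ∧
          (∀ a : ℝ, 0 < a → ∃ Λ₃ η₃ : ℝ, 0 < η₃ ∧ ∀ η ∈ Set.Ioo 0 η₃, ∀ s s' : unitInterval,
            1 - a * w η ≤ (γ s).1 → 1 - a * w η ≤ (γ s').1 →
              |Dρ k m F η (γ s)| + |Dc k m F η (γ s)| ≤
                Λ₃ * (|Dρ k m F η (γ s')| + |Dc k m F η (γ s')|)) ∧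
          (∃ a δ : ℝ, 0 < a ∧ 0 < δ ∧ δ ≤ 1 / 2 ∧ ∃ Λ₄ η₄ : ℝ, 0 < η₄ ∧
            ∀ η ∈ Set.Ioo 0 η₄, ∀ s s' : unitInterval,
              1 - 2 * δ ≤ (γ s).1 → (γ s).1 ≤ 1 - a * w η →
              1 - 2 * δ ≤ (γ s').1 → (γ s').1 ≤ 1 - a * w η →
                |Dρ k m F η (γ s)| + |Dc k m F η (γ s)| ≤
                  Λ₄ * (|Dρ k m F η (γ s')| + |Dc k m F η (γ s')|)))

include hSB hW0 hIB in
/-- **Bulk chart by leaf transport to the slice `ρ = 0`.**  For every depth `δ ∈ (0,½]`, clause (i)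
holds on `{s | ρ_s ≤ 1 − δ}`: the path points lie in a fixed band `[vlo, vhi]`
(`stub_pathPoint_lower/upper`, landed); `G(γ s) ≤ (Λ+1)∂cP(γ s)` (stub 1, `∂cP > 0` on the band by
`levelCurves_unconditional`); `∂cP(γ s) ≤ e^Θ ∂cP(0, c₀)` at the same level (proved transport + stub 3);
`∂cP(0,c₀) ≤ Λ₂ ∂cP(0,c₀')` inside the window of the slice (stub 2); `∂cP(0,c₀') ≤ e^Θ ∂cP(γ s') ≤
e^Θ G(γ s')` (transport + stub 3 again). -/
theorem bulkComparability_leaf {k : ℕ} (hk : k = 2 ∨ k = 3) {γ : unitInterval → ℝ × ℝ}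
    (hγ : PathOK k γ) {m : ℕ} (F : Fin m → Quad (Set.univ : Set ℂ)) (hm : 0 < m) {δ : ℝ}
    (hδ : 0 < δ) (hδ' : δ ≤ 1 / 2) :
    ∃ Λ₁ η₁ : ℝ, 0 < η₁ ∧ ∀ s s' : unitInterval, (γ s).1 ≤ 1 - δ → (γ s').1 ≤ 1 - δ →
      ∀ η ∈ Set.Ioo 0 η₁,
        |Dρ k m F η (γ s)| + |Dc k m F η (γ s)| ≤
          Λ₁ * (|Dρ k m F η (γ s')| + |Dc k m F η (γ s')|) := by
  -- a fixed band containing every path point (uniform non-degeneracy along the path, landed)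
  obtain ⟨v₁, η₅, hv₁, hη₅, hlo⟩ := stub_pathPoint_lower k hk γ hγ m F hm
  obtain ⟨v₂, η₆, hv₂, hη₆, hhi⟩ := stub_pathPoint_upper k hk γ hγ m F hm
  obtain ⟨vlo, vhi, hvlo, hvv, hvhi, hvlo_le, hle_vhi⟩ :
      ∃ vlo vhi : ℝ, 0 < vlo ∧ vlo < vhi ∧ vhi < 1 ∧ vlo ≤ v₁ ∧ v₂ ≤ vhi :=
    ⟨min (v₁ / 2) (1 / 4), max ((v₂ + 1) / 2) (3 / 4), lt_min (by linarith) (by norm_num),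
      lt_of_le_of_lt (min_le_right _ _) (lt_of_lt_of_le (by norm_num) (le_max_right _ _)),
      max_lt (by linarith) (by norm_num), le_trans (min_le_left _ _) (by linarith),
      le_trans (by linarith) (le_max_left _ _)⟩
  -- the four bulk kernels and the landed positivity of `∂cP` on the band
  obtain ⟨ΛR, ηR, hΛR, hηR, hslope⟩ := hSB k hk γ hγ m F hm δ hδ hδ'
  obtain ⟨Λ₂, η₂, hΛ₂, hη₂, hwin⟩ := hW0 k hk m F hm vlo vhi hvlo hvv hvhi
  obtain ⟨Θ, ηB, hΘ, hηB, hbet⟩ := hIB k hk m F hm δ hδ hδ' vlo vhi hvlo hvv hvhi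
  obtain ⟨ηT, hηT, htrans⟩ := sliceTransport_of_intBet k hk m F hm δ hδ hδ' vlo vhi hvlo hvv hvhi Θ hΘ
  obtain ⟨ηL, hηL, hcurves⟩ :=
    levelCurves_unconditional k hk γ hγ m F hm δ hδ hδ' vlo vhi hvlo hvv hvhi
  refine ⟨(ΛR + 1) * Λ₂ * (Real.exp Θ * Real.exp Θ),
    min (min (min η₅ η₆) (min ηR η₂)) (min (min ηB ηT) ηL),
    lt_min (lt_min (lt_min hη₅ hη₆) (lt_min hηR hη₂)) (lt_min (lt_min hηB hηT) hηL),
    fun s s' hs hs' η hη => ?_⟩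
  -- thresholds
  have hE : min (min (min η₅ η₆) (min ηR η₂)) (min (min ηB ηT) ηL) ≤ min (min η₅ η₆) (min ηR η₂) :=
    min_le_left _ _
  have hG : min (min (min η₅ η₆) (min ηR η₂)) (min (min ηB ηT) ηL) ≤ min (min ηB ηT) ηL :=
    min_le_right _ _
  have hη5 : η ∈ Set.Ioo 0 η₅ :=
    ⟨hη.1, lt_of_lt_of_le hη.2 (hE.trans ((min_le_left _ _).trans (min_le_left _ _)))⟩
  have hη6 : η ∈ Set.Ioo 0 η₆ :=
    ⟨hη.1, lt_of_lt_of_le hη.2 (hE.trans ((min_le_left _ _).trans (min_le_right _ _)))⟩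
  have hηR' : η ∈ Set.Ioo 0 ηR :=
    ⟨hη.1, lt_of_lt_of_le hη.2 (hE.trans ((min_le_right _ _).trans (min_le_left _ _)))⟩
  have hη2 : η ∈ Set.Ioo 0 η₂ :=
    ⟨hη.1, lt_of_lt_of_le hη.2 (hE.trans ((min_le_right _ _).trans (min_le_right _ _)))⟩
  have hηB' : η ∈ Set.Ioo 0 ηB :=
    ⟨hη.1, lt_of_lt_of_le hη.2 (hG.trans ((min_le_left _ _).trans (min_le_left _ _)))⟩
  have hηT' : η ∈ Set.Ioo 0 ηT :=
    ⟨hη.1, lt_of_lt_of_le hη.2 (hG.trans ((min_le_left _ _).trans (min_le_right _ _)))⟩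
  have hηL' : η ∈ Set.Ioo 0 ηL := ⟨hη.1, lt_of_lt_of_le hη.2 (hG.trans (min_le_right _ _))⟩
  -- the two path points: in the square, in the bulk, in the band
  have hsq := hγ.2.2.2.1 s
  have hsq' := hγ.2.2.2.1 s'
  have hρs : (γ s).1 ∈ Set.Icc (0 : ℝ) (1 - δ) := ⟨hsq.1.1, hs⟩
  have hρs' : (γ s').1 ∈ Set.Icc (0 : ℝ) (1 - δ) := ⟨hsq'.1.1, hs'⟩
  have hcs : (γ s).2 ∈ Set.Icc (0 : ℝ) 1 := hsq.2
  have hcs' : (γ s').2 ∈ Set.Icc (0 : ℝ) 1 := hsq'.2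
  have hband : ∀ t : unitInterval, P k m F η (γ t).1 (γ t).2 ∈ Set.Icc vlo vhi := fun t =>
    ⟨hvlo_le.trans (hlo η hη5 t), (hhi η hη6 t).trans hle_vhi⟩
  have h0I : (0 : ℝ) ∈ Set.Icc (0 : ℝ) (1 - δ) := ⟨le_rfl, by linarith⟩
  -- positivity of `∂cP` on the band
  obtain ⟨-, -, -, -, -, hpos, -⟩ := hcurves η hηL'
  -- transport of the two path points to the slice `ρ = 0` (proved transport fed with stub 3 at mesh `η`)
  obtain ⟨c₀, hc₀, hP₀, hle₀, hge₀⟩ :=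
    htrans η hηT' (hbet η hηB') (γ s).1 hρs (γ s).2 hcs (hband s)
  obtain ⟨c₀', hc₀', hP₀', hle₀', hge₀'⟩ :=
    htrans η hηT' (hbet η hηB') (γ s').1 hρs' (γ s').2 hcs' (hband s')
  rw [Prod.mk.eta] at hle₀ hge₀ hle₀' hge₀'
  -- positivity at the four points
  have ha : 0 < Dc k m F η (γ s) := by
    have := hpos _ hρs _ hcs (hband s); rwa [Prod.mk.eta] at this
  have ha' : 0 < Dc k m F η (γ s') := by
    have := hpos _ hρs' _ hcs' (hband s'); rwa [Prod.mk.eta] at this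
  have hb0 : P k m F η 0 c₀ ∈ Set.Icc vlo vhi := by rw [hP₀]; exact hband s
  have hb0' : P k m F η 0 c₀' ∈ Set.Icc vlo vhi := by rw [hP₀']; exact hband s'
  -- window stability on the slice
  have hwin' : Dc k m F η (0, c₀) ≤ Λ₂ * Dc k m F η (0, c₀') := hwin η hη2 c₀ hc₀ c₀' hc₀' hb0 hb0'
  -- the slope bound at `s`
  have hsl : |Dρ k m F η (γ s)| ≤ ΛR * Dc k m F η (γ s) := hslope η hηR' s hs
  -- assemble
  have hR0 : 0 ≤ ΛR + 1 := by linarith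
  have hΛ₂0 : 0 ≤ Λ₂ := hΛ₂.le
  have hexp0 : 0 ≤ Real.exp Θ := (Real.exp_pos Θ).le
  have habs : |Dc k m F η (γ s)| = Dc k m F η (γ s) := abs_of_pos ha
  have habs' : |Dc k m F η (γ s')| = Dc k m F η (γ s') := abs_of_pos ha'
  calc |Dρ k m F η (γ s)| + |Dc k m F η (γ s)|
      ≤ ΛR * Dc k m F η (γ s) + Dc k m F η (γ s) := by rw [habs]; exact add_le_add hsl le_rfl
    _ = (ΛR + 1) * Dc k m F η (γ s) := by ring
    _ ≤ (ΛR + 1) * (Real.exp Θ * Dc k m F η (0, c₀)) := mul_le_mul_of_nonneg_left hle₀ hR0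
    _ ≤ (ΛR + 1) * (Real.exp Θ * (Λ₂ * Dc k m F η (0, c₀'))) :=
        mul_le_mul_of_nonneg_left (mul_le_mul_of_nonneg_left hwin' hexp0) hR0
    _ ≤ (ΛR + 1) * (Real.exp Θ * (Λ₂ * (Real.exp Θ * Dc k m F η (γ s')))) :=
        mul_le_mul_of_nonneg_left
          (mul_le_mul_of_nonneg_left (mul_le_mul_of_nonneg_left hge₀' hΛ₂0) hexp0) hR0
    _ = (ΛR + 1) * Λ₂ * (Real.exp Θ * Real.exp Θ) * |Dc k m F η (γ s')| := by rw [habs']; ring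
    _ ≤ (ΛR + 1) * Λ₂ * (Real.exp Θ * Real.exp Θ) * (|Dρ k m F η (γ s')| + |Dc k m F η (γ s')|) :=
        mul_le_mul_of_nonneg_left (le_add_of_nonneg_left (abs_nonneg _)) (by positivity)

include hSB hW0 hIB hCO in
/-- **Clause (i):** the bulk chart (`bulkComparability_leaf`, at the depth `δ` delivered by the
corner chart) and the corner chart (`cornerComparability`, landed composition of stub 4) overlap on
`ρ ∈ [1−2δ, 1−δ]`, which the continuous path `(1,0) → (0,½)` visits (intermediate value theorem), so
one global constant results.  (Adapted from the landed `comparability` of line `Sketch`.) -/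
theorem comparability_leaf {k : ℕ} (hk : k = 2 ∨ k = 3) {γ : unitInterval → ℝ × ℝ}
    (hγ : PathOK k γ) {m : ℕ} (F : Fin m → Quad (Set.univ : Set ℂ)) (hm : 0 < m) :
    ∃ Λ η₀ : ℝ, 0 < Λ ∧ 0 < η₀ ∧ ∀ s s' : unitInterval, ∀ η ∈ Set.Ioo 0 η₀,
      |Dρ k m F η (γ s)| + |Dc k m F η (γ s)| ≤ Λ * (|Dρ k m F η (γ s')| + |Dc k m F η (γ s')|) := by
  obtain ⟨δ, hδ, hδ', Λ₂, η₂, hη₂, hcorner⟩ := cornerComparability hCO k hk γ hγ m F hm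
  obtain ⟨Λ₁, η₁, hη₁, hbulk⟩ := bulkComparability_leaf hSB hW0 hIB hk hγ F hm hδ hδ'
  -- an overlap point `s⋆` with `ρ_{s⋆} = 1 − 3δ/2`
  have hcont : Continuous fun s : unitInterval => (γ s).1 := continuous_fst.comp hγ.1
  have h0 : (γ 0).1 = 1 := by rw [hγ.2.1]
  have h1 : (γ 1).1 = 0 := by rw [hγ.2.2.1]
  have hmem : (1 - 3 / 2 * δ : ℝ) ∈ Set.Icc ((fun s : unitInterval => (γ s).1) 1)
      ((fun s : unitInterval => (γ s).1) 0) := by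
    simp only [h0, h1]
    constructor <;> nlinarith
  obtain ⟨sstar, -, hsstar⟩ := intermediate_value_Icc' zero_le_one hcont.continuousOn hmem
  simp only at hsstar
  have hstar_bulk : (γ sstar).1 ≤ 1 - δ := by rw [hsstar]; nlinarith
  have hstar_corner : 1 - 2 * δ ≤ (γ sstar).1 := by rw [hsstar]; nlinarith
  -- constants
  set L₁ := max Λ₁ 1 with hL₁
  set L₂ := max Λ₂ 1 with hL₂
  have hL₁1 : 1 ≤ L₁ := le_max_right _ _
  have hL₂1 : 1 ≤ L₂ := le_max_right _ _
  refine ⟨L₁ * L₂, min η₁ η₂, by positivity, lt_min hη₁ hη₂, fun s s' η hη => ?_⟩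
  have hη1 : η ∈ Set.Ioo 0 η₁ := ⟨hη.1, lt_of_lt_of_le hη.2 (min_le_left _ _)⟩
  have hη2 : η ∈ Set.Ioo 0 η₂ := ⟨hη.1, lt_of_lt_of_le hη.2 (min_le_right _ _)⟩
  set Gs := |Dρ k m F η (γ s)| + |Dc k m F η (γ s)| with hGs
  set Gs' := |Dρ k m F η (γ s')| + |Dc k m F η (γ s')| with hGs'
  set Gst := |Dρ k m F η (γ sstar)| + |Dc k m F η (γ sstar)| with hGst
  have hGs_nn : 0 ≤ Gs := by positivity
  have hGs'_nn : 0 ≤ Gs' := by positivity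
  have hGst_nn : 0 ≤ Gst := by positivity
  -- upgraded chart inequalities with the constants `L₁, L₂ ≥ 1`
  have bulk : ∀ a b : unitInterval, (γ a).1 ≤ 1 - δ → (γ b).1 ≤ 1 - δ →
      |Dρ k m F η (γ a)| + |Dc k m F η (γ a)| ≤ L₁ * (|Dρ k m F η (γ b)| + |Dc k m F η (γ b)|) := by
    intro a b ha hb
    have := hbulk a b ha hb η hη1
    have hnn : 0 ≤ |Dρ k m F η (γ b)| + |Dc k m F η (γ b)| := by positivity
    calc _ ≤ Λ₁ * (|Dρ k m F η (γ b)| + |Dc k m F η (γ b)|) := this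
      _ ≤ L₁ * (|Dρ k m F η (γ b)| + |Dc k m F η (γ b)|) := by gcongr; exact le_max_left _ _
  have corner : ∀ a b : unitInterval, 1 - 2 * δ ≤ (γ a).1 → 1 - 2 * δ ≤ (γ b).1 →
      |Dρ k m F η (γ a)| + |Dc k m F η (γ a)| ≤ L₂ * (|Dρ k m F η (γ b)| + |Dc k m F η (γ b)|) := by
    intro a b ha hb
    have := hcorner a b ha hb η hη2
    have hnn : 0 ≤ |Dρ k m F η (γ b)| + |Dc k m F η (γ b)| := by positivity
    calc _ ≤ Λ₂ * (|Dρ k m F η (γ b)| + |Dc k m F η (γ b)|) := this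
      _ ≤ L₂ * (|Dρ k m F η (γ b)| + |Dc k m F η (γ b)|) := by gcongr; exact le_max_left _ _
  -- every parameter lies in (at least) one chart
  have hchart : ∀ a : unitInterval, (γ a).1 ≤ 1 - δ ∨ 1 - 2 * δ ≤ (γ a).1 := by
    intro a
    by_cases h : (γ a).1 ≤ 1 - δ
    · exact Or.inl h
    · exact Or.inr (by rw [not_le] at h; nlinarith)
  rcases hchart s with hs | hs <;> rcases hchart s' with hs' | hs'
  · have hL₁0 : 0 ≤ L₁ := le_trans zero_le_one hL₁1
    calc Gs ≤ L₁ * Gs' := bulk s s' hs hs'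
      _ ≤ L₁ * L₂ * Gs' := by nlinarith [mul_nonneg (mul_nonneg hL₁0 hGs'_nn) (sub_nonneg.2 hL₂1)]
  · calc Gs ≤ L₁ * Gst := bulk s sstar hs hstar_bulk
      _ ≤ L₁ * (L₂ * Gs') := by gcongr; exact corner sstar s' hstar_corner hs'
      _ = L₁ * L₂ * Gs' := by ring
  · calc Gs ≤ L₂ * Gst := corner s sstar hs hstar_corner
      _ ≤ L₂ * (L₁ * Gs') := by gcongr; exact bulk sstar s' hstar_bulk hs'
      _ = L₁ * L₂ * Gs' := by ring
  · have hL₂0 : 0 ≤ L₂ := le_trans zero_le_one hL₂1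
    calc Gs ≤ L₂ * Gs' := corner s s' hs hs'
      _ ≤ L₁ * L₂ * Gs' := by nlinarith [mul_nonneg (mul_nonneg hL₂0 hGs'_nn) (sub_nonneg.2 hL₁1)]

include hSB hW0 hIB hCO in
/-- **The reduction theorem of the line: the four kernels imply the crux in its unfolded
(`gradientComparability_iff`) form.**  Type: `stub_slopeBound_bulk → stub_windowAtRhoZero →
stub_intBet → stub_cornerTwoCharts → <GradientComparability unfolded>`
(statements as section hypotheses).  Clause (i) from `comparability_leaf`; clause (ii) from clause (i)
at the pair `(s, 1)` and the landed divergence at the Bernoulli endpoint `γ 1 = (0,½)`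
(`divergesAt_zero_half`). -/
theorem gradientComparability_unfolded_of_leafKernels :
    ∀ k : ℕ, k = 2 ∨ k = 3 → ∀ γ : unitInterval → ℝ × ℝ, PathOK k γ →
      ∀ (m : ℕ) (F : Fin m → Quad (Set.univ : Set ℂ)), 0 < m → ∃ Λ η₀ : ℝ, 0 < η₀ ∧
        (∀ s s' : unitInterval, ∀ η ∈ Set.Ioo 0 η₀,
          |Dρ k m F η (γ s)| + |Dc k m F η (γ s)| ≤ Λ * (|Dρ k m F η (γ s')| + |Dc k m F η (γ s')|)) ∧
        ∀ N : ℝ, ∃ η₁ : ℝ, 0 < η₁ ∧ ∀ η ∈ Set.Ioo 0 η₁, ∀ s : unitInterval,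
          N ≤ |Dρ k m F η (γ s)| + |Dc k m F η (γ s)| := by
  intro k hk γ hγ m F hm
  obtain ⟨Λ, η₀, hΛ, hη₀, hcomp⟩ := comparability_leaf hSB hW0 hIB hCO hk hγ F hm
  refine ⟨Λ, η₀, hη₀, hcomp, fun N => ?_⟩
  obtain ⟨η₁, hη₁, hdiv⟩ := divergesAt_zero_half k hk m F hm (Λ * max N 0)
  refine ⟨min η₀ η₁, lt_min hη₀ hη₁, fun η hη s => ?_⟩
  have hη0 : η ∈ Set.Ioo 0 η₀ := ⟨hη.1, lt_of_lt_of_le hη.2 (min_le_left _ _)⟩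
  have hη1 : η ∈ Set.Ioo 0 η₁ := ⟨hη.1, lt_of_lt_of_le hη.2 (min_le_right _ _)⟩
  have hend : γ 1 = ((0 : ℝ), (1 / 2 : ℝ)) := hγ.2.2.1
  have h1 := hcomp 1 s η hη0
  rw [hend] at h1
  have h2 := hdiv η hη1
  have hGs : 0 ≤ |Dρ k m F η (γ s)| + |Dc k m F η (γ s)| := by positivity
  nlinarith [le_max_left N 0, le_max_right N 0]

end Glue

/-- **The line closes the crux modulo its four stubs — `GradientComparability` BY NAME** (the
reduction theorem instantiated with the four registered stubs; closed modulo their `sorry`s only;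
`gradientComparability_iff` is the definitional bridge of `CardySelfRefinementDefs`). -/
theorem GradientComparability_of : GradientComparability :=
  gradientComparability_iff.2
    (gradientComparability_unfolded_of_leafKernels stub_slopeBound_bulk stub_windowAtRhoZero stub_intBet
      stub_cornerTwoCharts)

end Summit.CriticalPhenomena.CardyFormulaZ2.Cruxes.GradientComparability.LevelCurveLogSlopeIdentity

end
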